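import Summits.BirchSwinnertonDyer.Rank1Residual.ManinAdditive.KatoShiftThreeLawsEdges
import Summits.BirchSwinnertonDyer.BirchSwinnertonDyer.Theorems.ManinLocalTwoThreeShiftSpanColumns
import Summits.BirchSwinnertonDyer.BirchSwinnertonDyer.Theorems.ManinLocalTwoThreePrimeClassGenerationThreeEdges
import HarnessLib

/-!
# Route `ManinLocalTwoThree`, crux C3 `ManinPrimeToThreeAtNine` (stmt-BirchSwinnertonDyer-22968), line `kato-shift-three`
# (es g6): the shift span `shiftClassSpan f {ℓ | ℓ₀ ≤ ℓ ∧ AdmissiblePrime W N ℓ}` BY NAME is prime-free and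
# `ℓ₀`-free, and E-es-19 `ShiftClassGenerationThree` is equivalent to its `ℓ₀ = 0` instance (line prover p3; helper,
# unconditional edges)

Instantiating `shiftSpan_admissible_eq_closure_columns` (`…ShiftSpanColumns`) at `ε = epsSign W`:
* `shiftClassSpan_admissiblePrime_eq_closure_columns` — for `9 ∣ N` and every `ℓ₀`,
  `shiftClassSpan f {ℓ | ℓ₀ ≤ ℓ ∧ AdmissiblePrime W N ℓ}` is the subgroup generated by the column differences
  `{∞, 3b/d}_f − {∞, b/d}_f` over `d ≠ 0`, `gcd(d, Nb) = 1`, `d ≡ 2 (mod 3)`, `d ≡ 3 (mod 4)` if `4 ∣ N`,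
  `(d/q) = ±epsSign W q` (sign by `q mod 4`) at the odd `q ∥ N`;
* `shiftClassSpan_admissiblePrime_eq_of_le` — it does not depend on `ℓ₀`;
* `shiftClassGenerationThree_iff_zero` — E-es-19 (`∀ ℓ₀`) ⟺ its `ℓ₀ = 0` instance.
Nothing about BSD, Manin's conjecture or E-es-19 itself is proved here.
-/

set_option autoImplicit false
set_option linter.dupNamespace false

noncomputable section

open scoped Classical MatrixGroups ModularForm BigOperators

open CongruenceSubgroup WeierstrassCurve
  Literature.NumberTheory.EllipticCurves Literature.NumberTheory.EllipticCurves.ModularForms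
  Summit.BirchSwinnertonDyer.Rank1Residual.ManinAdditive

namespace Summit.BirchSwinnertonDyer.BirchSwinnertonDyer.Theorems.ManinLocalTwoThree

/-- **The shift span by name is the column span.** For `9 ∣ N` and every `ℓ₀`,
`shiftClassSpan f {ℓ | ℓ₀ ≤ ℓ ∧ AdmissiblePrime W N ℓ}` equals the subgroup generated by the column differences
`{∞, 3b/d}_f − {∞, b/d}_f` over the admissible residue classes of `d` (`shiftSpan_admissible_eq_closure_columns` at
`ε = epsSign W`). [folklore] -/
theorem shiftClassSpan_admissiblePrime_eq_closure_columns (W : WeierstrassCurve ℚ) [W.IsElliptic] {N : ℕ}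
    [NeZero N] (f : CuspForm (Gamma0 N) 2) (h9 : 3 ^ 2 ∣ N) (ℓ₀ : ℕ) :
    shiftClassSpan f {ℓ | ℓ₀ ≤ ℓ ∧ AdmissiblePrime W N ℓ} =
      AddSubgroup.closure
        {z : ℂ | ∃ b d : ℤ, d ≠ 0 ∧ IsCoprime d (N * b) ∧ d % 3 = 2 ∧ (4 ∣ N → d % 4 = 3) ∧
            (∀ q ∈ N.primeFactors, q ≠ 2 → ¬ q ^ 2 ∣ N →
              jacobiSym d q = if q % 4 = 1 then epsSign W q else -epsSign W q) ∧
            z = modularSymbol f (((3 * b : ℤ) : ℚ) / d) - modularSymbol f ((b : ℚ) / d)} := by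
  have h := shiftSpan_admissible_eq_closure_columns f (epsSign W) (epsSign_eq_one_or W)
    (by norm_num at h9; exact h9) ℓ₀
  simp only [shiftClassSpan, shiftClass, primeClass, AdmissiblePrime, epsSign] at h ⊢
  exact h

/-- **The shift span by name does not depend on `ℓ₀`.** [folklore] -/
theorem shiftClassSpan_admissiblePrime_eq_of_le (W : WeierstrassCurve ℚ) [W.IsElliptic] {N : ℕ} [NeZero N]
    (f : CuspForm (Gamma0 N) 2) (h9 : 3 ^ 2 ∣ N) (ℓ₀ ℓ₁ : ℕ) :
    shiftClassSpan f {ℓ | ℓ₀ ≤ ℓ ∧ AdmissiblePrime W N ℓ} = shiftClassSpan f {ℓ | ℓ₁ ≤ ℓ ∧ AdmissiblePrime W N ℓ} := by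
  rw [shiftClassSpan_admissiblePrime_eq_closure_columns W f h9 ℓ₀,
    shiftClassSpan_admissiblePrime_eq_closure_columns W f h9 ℓ₁]

/-- **E-es-19 ⟺ its `ℓ₀ = 0` instance.** Since the shift span over admissible primes `ℓ ≥ ℓ₀` does not depend on
`ℓ₀`, the cofinal law `ShiftClassGenerationThree` (`∀ ℓ₀`) is equivalent to its single instance `ℓ₀ = 0`. Nothing is
asserted about E-es-19 itself. [folklore] -/
theorem shiftClassGenerationThree_iff_zero :
    ShiftClassGenerationThree ↔
      ∀ (W : WeierstrassCurve ℚ) [W.IsElliptic] {N : ℕ} [NeZero N] (f : CuspForm (Gamma0 N) 2),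
        IsNewformOf W f → 3 ^ 2 ∣ N → W.HasIrreducibleModPGaloisRep 3 →
        ∃ m : ℕ, ¬ 3 ∣ m ∧ ∀ z ∈ periodLattice f,
          (m : ℂ) * z ∈ shiftClassSpan f {ℓ | 0 ≤ ℓ ∧ AdmissiblePrime W N ℓ} := by
  rw [shiftClassGenerationThree_iff]
  constructor
  · intro H W _ N _ f hf h9 hirr
    exact H W f 0 hf h9 hirr
  · intro H W _ N _ f ℓ₀ hf h9 hirr
    obtain ⟨m, hm, hgen⟩ := H W f hf h9 hirr
    refine ⟨m, hm, fun z hz => ?_⟩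
    rw [shiftClassSpan_admissiblePrime_eq_of_le W f h9 ℓ₀ 0]
    exact hgen z hz

end Summit.BirchSwinnertonDyer.BirchSwinnertonDyer.Theorems.ManinLocalTwoThree

end
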